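import Literature.Computability.Cryptography.ObfuscatedGluedTrees

/-!
# Toolkit stub `toolkit_prp` — the keyed four-round Feistel permutation of `d`-bit vectors ON CODES
# (crux `WbwObfuscatedGluedTrees`, stmt-QuantumAdvantage-2340; line `knowledge-of-walk-split`, stage 3, piece G2a of `NbrBitFP`)

The permutation `prp P μ k d : Equiv.Perm (Fin d → Bool)` of
`Literature/Computability/Cryptography/ObfuscatedGluedTrees.lean` §4 is four Feistel rounds
`feistelPerm Sᵣ (roundFn P μ k d r)`, `S₀ = S₂ = lowHalf d`, `S₁ = S₃ = highHalf d`, composed by `Equiv.trans`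
(so `prp w = F₃ (F₂ (F₁ (F₀ w)))`).  We prove that the map
`(1^μ, k, 1^d, w) ↦ List.ofFn (prp P μ k d (fun i => w.getD i false))` is computed on codes by a polynomial-time
string function (`CodeFP`), from the PRF's evaluation map on codes (hypothesis `hP`, the field `FPData.prfEval`).

* §1 (lists): one round on LISTS.  With the mask `M = List.ofFn S` and `W = List.ofFn w`, the blanked vector lists to
  `zipWith (fun m b => !m && b) M W`, the round value `F (blank w)` lists to `Fl = prf P μ k d (bitsOf 8 r ++ blank)`
  (`roundFn`), and the new vector lists to `bxor W (zipWith (&&) M Fl)` (`prpKit_ofFn_feistelRound`: position `i` is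
  `W[i] ⊕ (M[i] ∧ Fl[i])`).  Composing four times gives `List.ofFn (prp … w)` (`prpKit_ofFn_prp`) and, every round
  being an involution, `List.ofFn ((prp …).symm w)` with the rounds in reverse order (`prpKit_ofFn_prp_symm`, used by
  the sibling stub `toolkit_prpSymm`).  The input vector `fun i => w.getD i false` lists to `fit d w`
  (`prpKit_ofFn_getD`), the masks to blocks of constant bits (`prpKit_ofFn_lowHalf`, `prpKit_ofFn_highHalf`).
* §2 (codes): the list programme in the tree's `CodeFP` algebra — `zipWith` of a Boolean connective on strings
  (`prpKit_strZipWith`, through `MachineA.explode_code` / `bitsToStr`), `d / 2` in unary (`prpKit_unHalf`), the masks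
  (`prpKit_lowMaskFP`, `prpKit_highMaskFP`), the PRF with fitted input and output (`prpKit_prfFP`, the proof of
  `FPData.prfFP` from `hP`), one round (`prpKit_roundFP`), and the assembly `toolkit_prp`.
[folklore]
-/

set_option linter.dupNamespace false

noncomputable section

namespace Summit.QuantumAdvantage.QuantumAdvantage.Theorems.WbwObfuscatedGluedTrees.KnowledgeOfWalk.Generator

open Literature.Computability.Cryptography Literature.Computability.Complexity
open Literature.Computability.Cryptography.ObfuscatedGluedTrees Literature.Computability.QuantumComplexity
open Literature.Computability.Complexity.CodeFP (natE unE bitE pairE strE rawE)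

/-! ## §1 Feistel rounds on bit lists -/

section Lists

variable (P : PuncturablePRFScheme) (μ : ℕ) (k : List Bool)

/-- The blanked vector of a Feistel round (positions in `S` cleared), as a list: `zipWith (¬m ∧ b) (ofFn S) (ofFn v)`.
[folklore] -/
theorem prpKit_ofFn_blank {d : ℕ} (S v : Fin d → Bool) :
    List.ofFn (fun j => if S j then false else v j) =
      List.zipWith (fun m b => !m && b) (List.ofFn S) (List.ofFn v) := by
  apply List.ext_getElem (by simp)
  intro i h1 h2
  simp only [List.getElem_ofFn, List.getElem_zipWith]
  rcases Bool.eq_false_or_eq_true (S ⟨i, by simpa using h1⟩) with h | h <;> simp [h]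

/-- **One Feistel round with a PRF round function, on lists**: with `M = ofFn S`, `W = ofFn v`,
`ofFn (feistelRound S (roundFn P μ k d r) v) = W ⊕ (M ∧ prf P μ k d (⟨r⟩₈ ++ (¬M ∧ W)))` bitwise. [folklore] -/
theorem prpKit_ofFn_feistelRound {d : ℕ} (S : Fin d → Bool) (r : ℕ) (v : Fin d → Bool) :
    List.ofFn (feistelRound S (roundFn P μ k d r) v) =
      bxor (List.ofFn v) (List.zipWith (fun m b => m && b) (List.ofFn S)
        (prf P μ k d (bitsOf 8 r ++ List.zipWith (fun m b => !m && b) (List.ofFn S) (List.ofFn v)))) := by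
  unfold bxor
  apply List.ext_getElem (by simp)
  intro i h1 h2
  have hi : i < d := by simpa using h1
  simp only [List.getElem_zipWith, List.getElem_ofFn, feistelRound, ObfuscatedGluedTrees.roundFn]
  rw [prpKit_ofFn_blank S v, List.getD_eq_getElem _ _ (by simp [hi])]
  rcases Bool.eq_false_or_eq_true (S ⟨i, hi⟩) with h | h <;> simp [h]

/-- **The four rounds on lists**: for any list-level round map `R r M W = W ⊕ (M ∧ prf (⟨r⟩₈ ++ (¬M ∧ W)))`,
`ofFn (prp P μ k d v) = R 3 H (R 2 L (R 1 H (R 0 L (ofFn v))))` with the mask lists `L = ofFn (lowHalf d)`,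
`H = ofFn (highHalf d)` (`Equiv.trans f g x = g (f x)`). [folklore] -/
theorem prpKit_ofFn_prp {d : ℕ} (R : ℕ → List Bool → List Bool → List Bool)
    (hR : ∀ r M W, R r M W = bxor W (List.zipWith (fun m b => m && b) M
      (prf P μ k d (bitsOf 8 r ++ List.zipWith (fun m b => !m && b) M W)))) (v : Fin d → Bool) :
    List.ofFn (prp P μ k d v) =
      R 3 (List.ofFn (highHalf d)) (R 2 (List.ofFn (lowHalf d))
        (R 1 (List.ofFn (highHalf d)) (R 0 (List.ofFn (lowHalf d)) (List.ofFn v)))) := by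
  simp only [prp, Equiv.trans_apply, feistelPerm_apply, prpKit_ofFn_feistelRound, hR]

/-- **The inverse on lists**: every round is an involution, so `(prp …).symm` is the four rounds in reverse order,
`ofFn ((prp P μ k d).symm v) = R 0 L (R 1 H (R 2 L (R 3 H (ofFn v))))`. [folklore] -/
theorem prpKit_ofFn_prp_symm {d : ℕ} (R : ℕ → List Bool → List Bool → List Bool)
    (hR : ∀ r M W, R r M W = bxor W (List.zipWith (fun m b => m && b) M
      (prf P μ k d (bitsOf 8 r ++ List.zipWith (fun m b => !m && b) M W)))) (v : Fin d → Bool) :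
    List.ofFn ((prp P μ k d).symm v) =
      R 0 (List.ofFn (lowHalf d)) (R 1 (List.ofFn (highHalf d))
        (R 2 (List.ofFn (lowHalf d)) (R 3 (List.ofFn (highHalf d)) (List.ofFn v)))) := by
  simp only [prp, Equiv.symm_trans_apply, feistelPerm, Function.Involutive.toPerm_symm,
    Function.Involutive.coe_toPerm, prpKit_ofFn_feistelRound, hR]

/-- The input vector read off a string of ANY length lists to the fitted string:
`ofFn (fun i : Fin d => w.getD i false) = fit d w`. [folklore] -/
theorem prpKit_ofFn_getD (d : ℕ) (w : List Bool) :
    List.ofFn (fun i : Fin d => w.getD (i : ℕ) false) = fit d w := by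
  apply List.ext_getElem (by simp)
  intro i h1 h2
  rw [List.getElem_ofFn]
  simp only [fit, List.getElem_take, List.getElem_append, List.getElem_replicate]
  split_ifs with h
  · exact List.getD_eq_getElem _ _ h
  · exact List.getD_eq_default _ _ (Nat.le_of_not_lt h)

/-- The lower-half mask lists to `1^{d/2} 0^{d - d/2}`. [folklore] -/
theorem prpKit_ofFn_lowHalf (d : ℕ) :
    List.ofFn (lowHalf d) = List.replicate (d / 2) true ++ List.replicate (d - d / 2) false := by
  apply List.ext_getElem
  · simp only [List.length_ofFn, List.length_append, List.length_replicate]; omega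
  · intro i h1 h2
    rw [List.getElem_ofFn, List.getElem_append]
    simp only [List.length_replicate, List.getElem_replicate, lowHalf]
    split_ifs with h <;> simp [h]

/-- The upper-half mask lists to `0^{d/2} 1^{d - d/2}`. [folklore] -/
theorem prpKit_ofFn_highHalf (d : ℕ) :
    List.ofFn (highHalf d) = List.replicate (d / 2) false ++ List.replicate (d - d / 2) true := by
  apply List.ext_getElem
  · simp only [List.length_ofFn, List.length_append, List.length_replicate]; omega
  · intro i h1 h2
    rw [List.getElem_ofFn, List.getElem_append]
    simp only [List.length_replicate, List.getElem_replicate, highHalf]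
    split_ifs with h
    · simp [Nat.not_le.2 h]
    · simp [Nat.le_of_not_lt h]

end Lists

/-! ## §2 The list programme on codes -/

section Codes

open Literature.Computability.Complexity.CodeFP (strTake strDrop strAppend strLength strOfUn fst snd const
  unOfNatMin natDiv natOfUn bitsToStr unE_eq_ones unitE)

/-- **`zipWith` of a Boolean connective on two strings** (the strings exploded to raw bit lists, the tree's `zipWith`
with the connective tabulated by branching on the two bits, and back). [folklore] -/
theorem prpKit_strZipWith (g : Bool → Bool → Bool) :
    CodeFP (pairE strE strE) strE (fun p : List Bool × List Bool => List.zipWith g p.1 p.2) := by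
  have ha : CodeFP (pairE unitE (pairE bitE bitE)) bitE (fun t : Unit × Bool × Bool => t.2.1) := (snd _ _).fst'
  have hb : CodeFP (pairE unitE (pairE bitE bitE)) bitE (fun t : Unit × Bool × Bool => t.2.2) := (snd _ _).snd'
  have hg : CodeFP (pairE unitE (pairE bitE bitE)) bitE (fun t : Unit × Bool × Bool => g t.2.1 t.2.2) :=
    (ha.ite (hb.ite (const _ (g true true)) (const _ (g true false)))
      (hb.ite (const _ (g false true)) (const _ (g false false)))).congr fun t => by
        rcases t with ⟨u, a, b⟩
        cases a <;> cases b <;> rfl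
  have hz := CodeFP.zipWith (σ := Unit) (eσ := unitE) (eα := bitE) (eβ := bitE) (eγ := bitE)
    (g := fun t => g t.2.1 t.2.2) hg
  exact (bitsToStr.comp (hz.comp ((const _ ()).pair ((MachineA.explode_code.comp (fst _ _)).pair
    (MachineA.explode_code.comp (snd _ _)))))).congr fun _ => rfl

/-- `1^m ↦ 1^{m/2}` (through the binary quotient, capped back to unary by `m`). [folklore] -/
theorem prpKit_unHalf : CodeFP unE unE (fun m => m / 2) :=
  (unOfNatMin.comp ((CodeFP.id unE).pair (natDiv.comp (natOfUn.pair (const unE 2))))).congr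
    fun m => min_eq_left (Nat.div_le_self m 2)

/-- `1^d ↦` the lower-half mask `ofFn (lowHalf d) = 1^{d/2} 0^{d - d/2}`. [folklore] -/
theorem prpKit_lowMaskFP : CodeFP unE strE (fun d => List.ofFn (lowHalf d)) := by
  have ht : CodeFP unE strE (fun n => List.replicate n true) := strOfUn.congr fun n => unE_eq_ones n
  have hr : CodeFP unE unE (fun d => d - d / 2) := MachineA.unSub.comp ((CodeFP.id unE).pair prpKit_unHalf)
  exact (strAppend.comp ((ht.comp prpKit_unHalf).pair (MachineA.falses_code.comp hr))).congr fun d =>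
    (prpKit_ofFn_lowHalf d).symm

/-- `1^d ↦` the upper-half mask `ofFn (highHalf d) = 0^{d/2} 1^{d - d/2}`. [folklore] -/
theorem prpKit_highMaskFP : CodeFP unE strE (fun d => List.ofFn (highHalf d)) := by
  have ht : CodeFP unE strE (fun n => List.replicate n true) := strOfUn.congr fun n => unE_eq_ones n
  have hr : CodeFP unE unE (fun d => d - d / 2) := MachineA.unSub.comp ((CodeFP.id unE).pair prpKit_unHalf)
  exact (strAppend.comp ((MachineA.falses_code.comp prpKit_unHalf).pair (ht.comp hr))).congr fun d =>
    (prpKit_ofFn_highHalf d).symm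

variable (P : PuncturablePRFScheme)

/-- `(1^μ, k, 1^m, x) ↦ prf P μ k m x` from the PRF's evaluation map on codes (the proof of `FPData.prfFP` with the
bare hypothesis in place of the record field). [folklore] -/
theorem prpKit_prfFP
    (hP : CodeFP (pairE unE (pairE strE strE)) strE (fun p : ℕ × List Bool × List Bool => P.eval p.1 p.2.1 p.2.2)) :
    CodeFP (pairE unE (pairE strE (pairE unE strE))) strE
      (fun p : ℕ × List Bool × ℕ × List Bool => prf P p.1 p.2.1 p.2.2.1 p.2.2.2) := by
  have pμ : CodeFP (pairE unE (pairE strE (pairE unE strE))) unE (fun p : ℕ × List Bool × ℕ × List Bool => p.1) :=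
    fst _ _
  have pk : CodeFP (pairE unE (pairE strE (pairE unE strE))) strE (fun p : ℕ × List Bool × ℕ × List Bool => p.2.1) :=
    (snd _ _).fst'
  have pm : CodeFP (pairE unE (pairE strE (pairE unE strE))) unE (fun p : ℕ × List Bool × ℕ × List Bool => p.2.2.1) :=
    (snd _ _).snd'.fst'
  have px : CodeFP (pairE unE (pairE strE (pairE unE strE))) strE (fun p : ℕ × List Bool × ℕ × List Bool => p.2.2.2) :=
    (snd _ _).snd'.snd'
  have hin : CodeFP (pairE unE (pairE strE (pairE unE strE))) strE
      (fun p : ℕ × List Bool × ℕ × List Bool => fit p.1 p.2.2.2) :=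
    FPData.fitFP.comp (pμ.pair px)
  have hev : CodeFP (pairE unE (pairE strE (pairE unE strE))) strE
      (fun p : ℕ × List Bool × ℕ × List Bool => P.eval p.1 p.2.1 (fit p.1 p.2.2.2)) :=
    hP.comp (pμ.pair (pk.pair hin))
  exact (FPData.fitFP.comp (pm.pair hev)).congr fun _ => rfl

/-- **One round on codes**: from the codes of `μ`, `k`, `d`, the mask `M` and the current list `W` (all computed from a
common input `a`), the new list `W ⊕ (M ∧ prf P μ k d (⟨r⟩₈ ++ (¬M ∧ W)))`. [folklore] -/
theorem prpKit_roundFP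
    (hP : CodeFP (pairE unE (pairE strE strE)) strE (fun p : ℕ × List Bool × List Bool => P.eval p.1 p.2.1 p.2.2))
    {α : Type} {eα : α → List Bool} {fμ fd : α → ℕ} {fk fM fW : α → List Bool} (r : ℕ)
    (hμ : CodeFP eα unE fμ) (hk : CodeFP eα strE fk) (hd : CodeFP eα unE fd) (hM : CodeFP eα strE fM)
    (hW : CodeFP eα strE fW) :
    CodeFP eα strE (fun a => bxor (fW a) (List.zipWith (fun m b => m && b) (fM a)
      (prf P (fμ a) (fk a) (fd a) (bitsOf 8 r ++ List.zipWith (fun m b => !m && b) (fM a) (fW a))))) := by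
  have hB : CodeFP eα strE (fun a => bitsOf 8 r ++ List.zipWith (fun m b => !m && b) (fM a) (fW a)) :=
    strAppend.comp ((const eα (bitsOf 8 r)).pair ((prpKit_strZipWith _).comp (hM.pair hW)))
  have hF : CodeFP eα strE
      (fun a => prf P (fμ a) (fk a) (fd a) (bitsOf 8 r ++ List.zipWith (fun m b => !m && b) (fM a) (fW a))) :=
    (prpKit_prfFP P hP).comp (hμ.pair (hk.pair (hd.pair hB)))
  exact ((prpKit_strZipWith _).comp (hW.pair ((prpKit_strZipWith _).comp (hM.pair hF)))).congr fun _ => rfl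

/-- **TOOLKIT G2a — the keyed Feistel permutation on codes**: `(1^μ, k, 1^d, w) ↦ prp P μ k d (w as a d-bit
vector)`, listed back as a string of length `d`: fit `w` to `d` bits, apply the four list rounds with the two mask
strings, and identify the result with `List.ofFn (prp …)` by `prpKit_ofFn_prp` / `prpKit_ofFn_getD`. [folklore] -/
theorem toolkit_prp :
    ∀ (P : PuncturablePRFScheme),
      Literature.Computability.Complexity.CodeFP (pairE unE (pairE strE strE)) strE
        (fun p : ℕ × List Bool × List Bool => P.eval p.1 p.2.1 p.2.2) →
      Literature.Computability.Complexity.CodeFP (pairE unE (pairE strE (pairE unE strE))) strE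
        (fun t : ℕ × List Bool × ℕ × List Bool =>
          List.ofFn ((prp P t.1 t.2.1 t.2.2.1) (fun i : Fin t.2.2.1 => t.2.2.2.getD (i : ℕ) false))) := by
  intro P hP
  have pμ : CodeFP (pairE unE (pairE strE (pairE unE strE))) unE (fun t : ℕ × List Bool × ℕ × List Bool => t.1) :=
    fst _ _
  have pk : CodeFP (pairE unE (pairE strE (pairE unE strE))) strE (fun t : ℕ × List Bool × ℕ × List Bool => t.2.1) :=
    (snd _ _).fst'
  have pd : CodeFP (pairE unE (pairE strE (pairE unE strE))) unE (fun t : ℕ × List Bool × ℕ × List Bool => t.2.2.1) :=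
    (snd _ _).snd'.fst'
  have pw : CodeFP (pairE unE (pairE strE (pairE unE strE))) strE (fun t : ℕ × List Bool × ℕ × List Bool => t.2.2.2) :=
    (snd _ _).snd'.snd'
  have hL : CodeFP (pairE unE (pairE strE (pairE unE strE))) strE
      (fun t : ℕ × List Bool × ℕ × List Bool => List.ofFn (lowHalf t.2.2.1)) :=
    prpKit_lowMaskFP.comp pd
  have hH : CodeFP (pairE unE (pairE strE (pairE unE strE))) strE
      (fun t : ℕ × List Bool × ℕ × List Bool => List.ofFn (highHalf t.2.2.1)) :=
    prpKit_highMaskFP.comp pd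
  have h0 : CodeFP (pairE unE (pairE strE (pairE unE strE))) strE
      (fun t : ℕ × List Bool × ℕ × List Bool => fit t.2.2.1 t.2.2.2) :=
    FPData.fitFP.comp (pd.pair pw)
  have h1 := prpKit_roundFP P hP 0 pμ pk pd hL h0
  have h2 := prpKit_roundFP P hP 1 pμ pk pd hH h1
  have h3 := prpKit_roundFP P hP 2 pμ pk pd hL h2
  have h4 := prpKit_roundFP P hP 3 pμ pk pd hH h3
  refine h4.congr fun t => ?_
  rw [prpKit_ofFn_prp P t.1 t.2.1 (fun r M W => bxor W (List.zipWith (fun m b => m && b) M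
      (prf P t.1 t.2.1 t.2.2.1 (bitsOf 8 r ++ List.zipWith (fun m b => !m && b) M W)))) (fun _ _ _ => rfl),
    prpKit_ofFn_getD]

end Codes

end Summit.QuantumAdvantage.QuantumAdvantage.Theorems.WbwObfuscatedGluedTrees.KnowledgeOfWalk.Generator

end
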